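import Summits.QuantumFields.YangMills.Theorems.UnitScaleTiltProp7TransportedInterpolant
import Summits.QuantumFields.YangMills.Theorems.UnitScaleTiltProp7CovariantBlockBumpsProfile
import HarnessLib

/-!
# Route `UnitScaleTilt`, crux K1 «MinimiserStabilityRegPr» (stmt-QuantumFields-19200), EX face — K-storey (px12 g16 LOCATE-K137), pen (K1b-a) (px13 g15; LOCATE #43 §6 (F2d)) —
# **THE TRANSPORTED INTERPOLANT AT THE SKEW ⊗ PARABOLA² PROFILE: `θ ≤ ½` AND `C₁ ≤ 45·√(c₀ℓ³∕cB)` — K-FREE AT THE PIN `cB = c₀ℓ³`**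

Cell `ym3-torus` (HUMAN RULING D-0037; rung R3 = SU(2) YM₃ on T³ — NOT d = 4, NOT infinite volume, NOT a mass gap, NOT Clay).  Width seat `ym3-torus-px13` (gen 15).  THEOREMS ONLY
(0 `def`, 0 `sorry`); `--supports stmt-QuantumFields-19200 --as helper`; count-neutral; nothing of Bałaban's asserted.

THE NUMBERS (`ℓ = L^k ≥ 3`, `ℓ₁ = ⌊ℓ∕4⌋ + 1`, `s₀ = ℓ − ℓ₁`).  μ-profile = ✓`Prop7SkewBumpProfile`'s skew `p(s) = (s + 1 − s₀)₊·(ℓ − s)` (so `3·SPILL ≤ OWN`, ✓`three_mul_sum_spill_le_sum_own`);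
transverse profile = ✓`Prop7CovariantBlockBumpsProfile`'s parabola `τ(m) = m(ℓ − 1 − m)` (`T = ℓ(ℓ−1)(ℓ−2)∕6 ≥ ℓ³∕27`).  §1: `ℓ³·Σp² ≤ 43·OWN²` (`p ≤ ℓ₁²`, `(s₀+1)Σp ≤ OWN`, F1's floor
`OWN ≥ (ℓ−⌊ℓ∕4⌋)ℓ₁(ℓ₁+1)(ℓ₁+2)∕6`); §2: `16ℓ²·(Στ²)² ≤ 729·T⁴` (`τ ≤ ℓ²∕4`); hence `m̂⁻²Ψ₂ = ℓ⁸·Σp²·(Στ²)²∕(OWN²T⁴) ≤ 1960·ℓ³` and the radicand of row (a)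
`6ρ·m̂⁻²Ψ₂∕ℓ³ ≤ 11757ρ`; §3: in the window `10¹⁰L⁶ε₀ ≤ 1` the ENGINE's constant `ρ = 4(3·10¹⁰L¹⁰ε₀² + 192(ℓ·2a₀(3(ℓ−1)+7ℓ))²) ≤ 10⁻⁸` (`a₀ = ε₀ℓ⁻²`), so `θ = SPILL∕OWN + √(…) ≤ ⅓ + ⅙ = ½`.

WHAT IS PROVED (ns `…Theorems.Prop7TransportedInterpolantOfRegPr`).
* §1–§3 the arithmetic above (`cube_mul_sum_skew_sq_le`, `sq_mul_sum_tau_sq_sq_le`, `rho_le`, …).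
* §4 ★★★ `exists_transportedInterpolant_of_regPr` — `RegPr F n K ε₀ U₀`, `10¹⁰L⁶ε₀ ≤ 1`, `10¹²L³ε₀ ≤ 1`, `n < K`, no-wrap `2(3(ℓ−1) + 8ℓ + 1) ≤ (F.P K).sitesPerDir 0` ⟹
  `∃ E : WL2 →ₗ[ℂ] BondL2K`, (formula, for (s2)) ∧ `∀ c, ‖Q_k(U₀)(E c) − c‖ ≤ ½‖c‖` ∧ `∀ c, ‖E c‖ ≤ 45·√(c₀·ℓ³∕cB)·‖c‖` — px12's ✓p767561 letters `hQE` (`θ = ½`) and `hE₁` (`C₁ = 45√(c₀ℓ³∕cB)`,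
  `= 45` at the pin); `hED` ((s2)) is F3.
HONEST SCOPE.  (s2), (K1b), K137, EX and the crux are NOT proved here.

References: T. Bałaban, CMP **99** (1985) 389–434 [Balaban1985BackgroundPropagators] ((3.13)–(3.16) p.393, (3.126)–(3.132) pp.420–422); CMP **95** (1984) 17–40 [Balaban1984PropagatorsI]
((1.18) p.20, (1.47)–(1.50) p.26); CMP **102** (1985) 277–309 [Balaban1985Variational] ((6) p.278).
-/

set_option autoImplicit false

noncomputable section

open scoped BigOperators Matrix.Norms.L2Operator Matrix

namespace Summit.QuantumFields.YangMills.Theorems.Prop7TransportedInterpolantOfRegPr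

open Literature.MathematicalPhysics.QuantumFieldTheory.Balaban1983to89
open Literature.MathematicalPhysics.QuantumFieldTheory.Balaban1983to89.T3ContinuumYM3Torus
open Finset T4Continuum BlockAveraging LatticeFieldCalculus B1RG242Torus
open B5Eq118OneStroke (iterBlockOf)
open B7Eq78Linearization (conjR)
open B9Eq311L2Pairing (WL2)
open B10Eq27TorusAxialLog (axialT unitsField toUField suIncl)
open B11Eq103H1Complex (BondL2K)
open B15DeterminingSets (embIter)
open T3LevelShift (bondShift)
open T3PrintedRegularOrbits (sites_eq)
open T3PrintedRegularMinimiser (RegPr)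
open T3RegularMinimiser (regThreshold regThreshold_pos)
open T3SectALandauChart (eta)
open Summit.QuantumFields.YangMills.Theorems.Prop7SectET3Transport (periodsT3)
open Summit.QuantumFields.YangMills.Theorems.Prop7SectET3HilbertLetters (W₂ toL2 toL2B)
open Summit.QuantumFields.YangMills.Theorems.Prop7SectET3CurvedPropagators (Qk)
open Summit.QuantumFields.YangMills.Theorems.Prop7SkewBumpProfile (skew_nonneg skew_eq_zero_of_lt skew_le sum_own_ge three_mul_sum_spill_le_sum_own)
open Summit.QuantumFields.YangMills.Theorems.Prop7CovariantBlockBumpsProfile (tau_nonneg tau_le sum_tau_eq mass_ge)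
open Summit.QuantumFields.YangMills.Theorems.Prop7TransportedInterpolant (exists_transportedInterpolant)

/-! ## §1 The skew profile: `ℓ³·Σp² ≤ 43·OWN²` -/

section Skew

/-- `(ℓ − ⌊ℓ∕4⌋)·Σ_s p(s) ≤ OWN = Σ_s (s+1)p(s)` — the skew profile lives on `s ≥ s₀ = ℓ − ⌊ℓ∕4⌋ − 1`. [folklore] -/
theorem floor_mul_sum_skew_le_own (ℓ : ℕ) :
    ((ℓ - ℓ / 4 : ℕ) : ℝ) * ∑ s ∈ range ℓ, (((s + 1 - (ℓ - (ℓ / 4 + 1)) : ℕ) : ℝ) * ((ℓ : ℝ) - s))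
      ≤ ∑ s ∈ range ℓ, ((s : ℝ) + 1) * (((s + 1 - (ℓ - (ℓ / 4 + 1)) : ℕ) : ℝ) * ((ℓ : ℝ) - s)) := by
  rw [Finset.mul_sum]
  refine Finset.sum_le_sum fun s hs => ?_
  have hs' := Finset.mem_range.mp hs
  by_cases hlt : s + 1 ≤ ℓ - (ℓ / 4 + 1)
  · rw [skew_eq_zero_of_lt hlt, mul_zero, mul_zero]
  · have hge : ((ℓ - ℓ / 4 : ℕ) : ℝ) ≤ (s : ℝ) + 1 := by
      have : ℓ - ℓ / 4 ≤ s + 1 := by omega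
      exact_mod_cast this
    exact mul_le_mul_of_nonneg_right hge (skew_nonneg hs')

/-- `Σ_s p(s)² ≤ ℓ₁²·Σ_s p(s)` (`0 ≤ p ≤ ℓ₁²`). [folklore] -/
theorem sum_skew_sq_le (ℓ : ℕ) :
    ∑ s ∈ range ℓ, (((s + 1 - (ℓ - (ℓ / 4 + 1)) : ℕ) : ℝ) * ((ℓ : ℝ) - s)) ^ 2
      ≤ (((ℓ / 4 + 1 : ℕ) : ℝ)) ^ 2 * ∑ s ∈ range ℓ, (((s + 1 - (ℓ - (ℓ / 4 + 1)) : ℕ) : ℝ) * ((ℓ : ℝ) - s)) := by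
  rw [Finset.mul_sum]
  refine Finset.sum_le_sum fun s hs => ?_
  have hs' := Finset.mem_range.mp hs
  rw [sq]
  exact mul_le_mul_of_nonneg_right (skew_le hs') (skew_nonneg hs')

/-- ★ **THE SKEW RATIO**: `ℓ³·Σ_s p(s)² ≤ 43·OWN²` (`1 ≤ ℓ`). [folklore] -/
theorem cube_mul_sum_skew_sq_le {ℓ : ℕ} (hℓ : 1 ≤ ℓ) :
    (ℓ : ℝ) ^ 3 * ∑ s ∈ range ℓ, (((s + 1 - (ℓ - (ℓ / 4 + 1)) : ℕ) : ℝ) * ((ℓ : ℝ) - s)) ^ 2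
      ≤ 43 * (∑ s ∈ range ℓ, ((s : ℝ) + 1) * (((s + 1 - (ℓ - (ℓ / 4 + 1)) : ℕ) : ℝ) * ((ℓ : ℝ) - s))) ^ 2 := by
  set OWN := ∑ s ∈ range ℓ, ((s : ℝ) + 1) * (((s + 1 - (ℓ - (ℓ / 4 + 1)) : ℕ) : ℝ) * ((ℓ : ℝ) - s)) with hOWN
  set S1 := ∑ s ∈ range ℓ, (((s + 1 - (ℓ - (ℓ / 4 + 1)) : ℕ) : ℝ) * ((ℓ : ℝ) - s)) with hS1
  have h1 := floor_mul_sum_skew_le_own ℓ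
  have h2 := sum_skew_sq_le ℓ
  have h3 := sum_own_ge ℓ hℓ
  rw [← hOWN] at h1 h3
  rw [← hS1] at h1 h2
  -- the integers `q = ⌊ℓ∕4⌋`, `ℓ − q`
  set q : ℕ := ℓ / 4 with hq
  have hq4 : 4 * q ≤ ℓ := by omega
  have hlq : ((ℓ - q : ℕ) : ℝ) = (ℓ : ℝ) - q := by rw [Nat.cast_sub (by omega)]
  rw [hlq] at h1 h3
  have hqr : 4 * (q : ℝ) ≤ ℓ := by exact_mod_cast hq4
  have hℓr : (1 : ℝ) ≤ ℓ := by exact_mod_cast hℓ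
  have hq0 : (0 : ℝ) ≤ q := Nat.cast_nonneg _
  have hS1nn : 0 ≤ S1 := Finset.sum_nonneg fun s hs => skew_nonneg (Finset.mem_range.mp hs)
  have hOWNnn : 0 ≤ OWN := Finset.sum_nonneg fun s hs => mul_nonneg (by positivity) (skew_nonneg (Finset.mem_range.mp hs))
  push_cast at h2 h3
  -- `Σp² ≤ ℓ₁² S1`, `(ℓ − q) S1 ≤ OWN`, `OWN ≥ (ℓ−q)(q+1)(q+2)(q+3)/6`
  have hA : (ℓ : ℝ) ^ 3 * ∑ s ∈ range ℓ, (((s + 1 - (ℓ - (ℓ / 4 + 1)) : ℕ) : ℝ) * ((ℓ : ℝ) - s)) ^ 2 ≤ (ℓ : ℝ) ^ 3 * (((q : ℝ) + 1) ^ 2 * S1) :=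
    mul_le_mul_of_nonneg_left h2 (by positivity)
  refine hA.trans ?_
  -- reduce to `ℓ³ (q+1)² S1 ≤ 43 OWN²` using `(ℓ−q) S1 ≤ OWN` and the floor
  have hlq0 : (3 : ℝ) / 4 * ℓ ≤ (ℓ : ℝ) - q := by linarith
  have hlqnn : (0 : ℝ) ≤ (ℓ : ℝ) - q := by linarith
  have hfl : ((ℓ : ℝ) - q) * (((q : ℝ) + 1) * ((q : ℝ) + 1 + 1) * ((q : ℝ) + 1 + 2) / 6) ≤ OWN := h3
  have hkey : (ℓ : ℝ) ^ 3 * ((q : ℝ) + 1) ^ 2 ≤ 43 * (((ℓ : ℝ) - q) * (((ℓ : ℝ) - q) * (((q : ℝ) + 1) * ((q : ℝ) + 1 + 1) * ((q : ℝ) + 1 + 2) / 6))) := by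
    -- `43 (ℓ−q)² (q+1)(q+2)(q+3)/6 ≥ 43·(9ℓ²/16)(q+1)(q+1)(ℓ/4)/6 ≥ ℓ³ (q+1)²`
    have hq3 : (ℓ : ℝ) / 4 ≤ (q : ℝ) + 1 + 2 := by
      have : (ℓ : ℝ) < 4 * ((q : ℝ) + 1) := by
        have : ℓ < 4 * (q + 1) := by omega
        exact_mod_cast this
      linarith
    have hmono : 0 ≤ (ℓ : ℝ) ^ 3 * ((q : ℝ) + 1) ^ 2 := by positivity
    calc (ℓ : ℝ) ^ 3 * ((q : ℝ) + 1) ^ 2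
        ≤ (387 / 384 : ℝ) * ((ℓ : ℝ) ^ 3 * ((q : ℝ) + 1) ^ 2) := le_mul_of_one_le_left hmono (by norm_num)
      _ = 43 * (((3 : ℝ) / 4 * ℓ) * (((3 : ℝ) / 4 * ℓ) * (((q : ℝ) + 1) * ((q : ℝ) + 1) * ((ℓ : ℝ) / 4) / 6))) := by ring
      _ ≤ 43 * (((ℓ : ℝ) - q) * (((ℓ : ℝ) - q) * (((q : ℝ) + 1) * ((q : ℝ) + 1 + 1) * ((q : ℝ) + 1 + 2) / 6))) := by
          gcongr
          linarith
  calc (ℓ : ℝ) ^ 3 * (((q : ℝ) + 1) ^ 2 * S1) = ((ℓ : ℝ) ^ 3 * ((q : ℝ) + 1) ^ 2) * S1 := by ring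
    _ ≤ (43 * (((ℓ : ℝ) - q) * (((ℓ : ℝ) - q) * (((q : ℝ) + 1) * ((q : ℝ) + 1 + 1) * ((q : ℝ) + 1 + 2) / 6)))) * S1 :=
        mul_le_mul_of_nonneg_right hkey hS1nn
    _ = 43 * ((((ℓ : ℝ) - q) * (((q : ℝ) + 1) * ((q : ℝ) + 1 + 1) * ((q : ℝ) + 1 + 2) / 6)) * (((ℓ : ℝ) - q) * S1)) := by ring
    _ ≤ 43 * (OWN * OWN) :=
        mul_le_mul_of_nonneg_left (mul_le_mul hfl h1 (mul_nonneg hlqnn hS1nn) hOWNnn) (by norm_num)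
    _ = 43 * OWN ^ 2 := by ring

/-- `0 ≤ SPILL` for the skew profile. [folklore] -/
theorem sum_spill_skew_nonneg (ℓ : ℕ) :
    0 ≤ ∑ s ∈ range ℓ, ((ℓ : ℝ) - 1 - s) * (((s + 1 - (ℓ - (ℓ / 4 + 1)) : ℕ) : ℝ) * ((ℓ : ℝ) - s)) :=
  Finset.sum_nonneg fun s hs => by
    have hs' := Finset.mem_range.mp hs
    have : (s : ℝ) + 1 ≤ ℓ := by exact_mod_cast hs'
    exact mul_nonneg (by linarith) (skew_nonneg hs')

/-- `0 < OWN` for the skew profile (`1 ≤ ℓ`). [folklore] -/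
theorem sum_own_skew_pos {ℓ : ℕ} (hℓ : 1 ≤ ℓ) :
    0 < ∑ s ∈ range ℓ, ((s : ℝ) + 1) * (((s + 1 - (ℓ - (ℓ / 4 + 1)) : ℕ) : ℝ) * ((ℓ : ℝ) - s)) := by
  refine lt_of_lt_of_le ?_ (sum_own_ge ℓ hℓ)
  have h1 : (0 : ℝ) < ((ℓ - ℓ / 4 : ℕ) : ℝ) := by
    have : 0 < ℓ - ℓ / 4 := by omega
    exact_mod_cast this
  positivity

end Skew

/-! ## §2 The parabola: `16ℓ²·(Στ²)² ≤ 729·T⁴` -/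

section Parabola

/-- `Σ_m τ(m)² ≤ (ℓ²∕4)·Σ_m τ(m)` (`0 ≤ τ ≤ ℓ²∕4`). [folklore] -/
theorem sum_tau_sq_le (ℓ : ℕ) :
    ∑ m ∈ range ℓ, ((m : ℝ) * ((ℓ : ℝ) - 1 - m)) ^ 2 ≤ (ℓ : ℝ) ^ 2 / 4 * ∑ m ∈ range ℓ, (m : ℝ) * ((ℓ : ℝ) - 1 - m) := by
  rw [Finset.mul_sum]
  refine Finset.sum_le_sum fun m hm => ?_
  rw [sq]
  exact mul_le_mul_of_nonneg_right (tau_le m) (tau_nonneg (Finset.mem_range.mp hm))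

/-- ★ **THE PARABOLA RATIO**: `16ℓ²·(Σ_m τ(m)²)² ≤ 729·(Σ_m τ(m))⁴` (`3 ≤ ℓ`, `T ≥ ℓ³∕27`). [folklore] -/
theorem sq_mul_sum_tau_sq_sq_le {ℓ : ℕ} (hℓ : 3 ≤ ℓ) :
    16 * (ℓ : ℝ) ^ 2 * (∑ m ∈ range ℓ, ((m : ℝ) * ((ℓ : ℝ) - 1 - m)) ^ 2) ^ 2 ≤ 729 * (∑ m ∈ range ℓ, (m : ℝ) * ((ℓ : ℝ) - 1 - m)) ^ 4 := by
  set T := ∑ m ∈ range ℓ, (m : ℝ) * ((ℓ : ℝ) - 1 - m) with hT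
  have h1 := sum_tau_sq_le ℓ
  rw [← hT] at h1
  have hTge : (ℓ : ℝ) ^ 3 / 27 ≤ T := by rw [hT, sum_tau_eq]; exact mass_ge hℓ
  have hℓ0 : (0 : ℝ) ≤ ℓ := Nat.cast_nonneg _
  have hT0 : 0 ≤ T := le_trans (by positivity) hTge
  have hS0 : 0 ≤ ∑ m ∈ range ℓ, ((m : ℝ) * ((ℓ : ℝ) - 1 - m)) ^ 2 := Finset.sum_nonneg fun _ _ => sq_nonneg _
  have h2 : (∑ m ∈ range ℓ, ((m : ℝ) * ((ℓ : ℝ) - 1 - m)) ^ 2) ^ 2 ≤ ((ℓ : ℝ) ^ 2 / 4 * T) ^ 2 := pow_le_pow_left₀ hS0 h1 2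
  have h3 : (ℓ : ℝ) ^ 6 ≤ 729 * T ^ 2 := by nlinarith [hTge, pow_nonneg hℓ0 3]
  calc 16 * (ℓ : ℝ) ^ 2 * (∑ m ∈ range ℓ, ((m : ℝ) * ((ℓ : ℝ) - 1 - m)) ^ 2) ^ 2
      ≤ 16 * (ℓ : ℝ) ^ 2 * ((ℓ : ℝ) ^ 2 / 4 * T) ^ 2 := mul_le_mul_of_nonneg_left h2 (by positivity)
    _ = (ℓ : ℝ) ^ 6 * T ^ 2 := by ring
    _ ≤ (729 * T ^ 2) * T ^ 2 := mul_le_mul_of_nonneg_right h3 (by positivity)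
    _ = 729 * T ^ 4 := by ring

/-- `0 < T` (`3 ≤ ℓ`). [folklore] -/
theorem sum_tau_pos {ℓ : ℕ} (hℓ : 3 ≤ ℓ) : 0 < ∑ m ∈ range ℓ, (m : ℝ) * ((ℓ : ℝ) - 1 - m) := by
  rw [sum_tau_eq]
  have : (3 : ℝ) ≤ ℓ := by exact_mod_cast hℓ
  exact lt_of_lt_of_le (by positivity) (mass_ge hℓ)

end Parabola

/-! ## §3 The window arithmetic -/

section Window

variable (F : T3Family) (n K : ℕ)

/-- `a₀·ℓ² = ε₀` (`a₀ = regThreshold = ε₀L^{−2(K−n)}`, `ℓ = L^{K−n}`). [cite: Balaban1985Variational, (6) p.278] -/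
theorem regThreshold_mul_sq (ε₀ : ℝ) : regThreshold F n K ε₀ * ((F.L : ℝ) ^ (K - n)) ^ 2 = ε₀ := by
  have hL0 : (F.L : ℝ) ≠ 0 := by have := F.hL.2; exact_mod_cast (show F.L ≠ 0 by omega)
  show ε₀ * ((F.L : ℝ)⁻¹) ^ (2 * (K - n)) * ((F.L : ℝ) ^ (K - n)) ^ 2 = ε₀
  rw [← pow_mul, mul_comm (K - n) 2, inv_pow, mul_assoc, inv_mul_cancel₀ (pow_ne_zero _ hL0), mul_one]

/-- ★ **THE ENGINE'S CONSTANT IN THE WINDOW**: `10¹⁰L⁶ε₀ ≤ 1`, `0 < ε₀` ⟹ `ρ = 4(3·10¹⁰L¹⁰ε₀² + 192(ℓ·2a₀(3(ℓ−1) + 7ℓ))²) ≤ 10⁻⁸`.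
[cite: Balaban1985BackgroundPropagators, (3.13)–(3.16) p.393] -/
theorem rho_le {ε₀ : ℝ} (hε₀ : 0 < ε₀) (hε : 10 ^ 10 * (F.L : ℝ) ^ 6 * ε₀ ≤ 1) :
    4 * (3 * 10 ^ 10 * (F.L : ℝ) ^ 10 * ε₀ ^ 2
        + 192 * ((F.L : ℝ) ^ (K - n) * (2 * regThreshold F n K ε₀ * (((((F.P K).d * ((F.P K).L ^ (K - n) - 1) : ℕ)) : ℝ) + 7 * (F.L : ℝ) ^ (K - n)))) ^ 2)
      ≤ (10 : ℝ)⁻¹ ^ 8 := by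
  have hL1 : (1 : ℝ) ≤ F.L := by have := F.hL.2; exact_mod_cast (show 1 ≤ F.L by omega)
  have hℓ1 : (1 : ℝ) ≤ (F.L : ℝ) ^ (K - n) := one_le_pow₀ hL1
  have ha₀ := regThreshold_pos F (n := n) (K := K) hε₀
  -- the second term: `ℓ·2a₀(3(ℓ−1) + 7ℓ) ≤ 20ε₀`
  have hcast : (((((F.P K).d * ((F.P K).L ^ (K - n) - 1) : ℕ)) : ℝ)) ≤ 3 * (F.L : ℝ) ^ (K - n) := by
    have h3 : (F.P K).d * ((F.P K).L ^ (K - n) - 1) ≤ 3 * F.L ^ (K - n) := by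
      rw [T3Family.P_d]; exact Nat.mul_le_mul_left 3 (Nat.sub_le _ _)
    exact_mod_cast h3
  have h2 : (F.L : ℝ) ^ (K - n) * (2 * regThreshold F n K ε₀ * (((((F.P K).d * ((F.P K).L ^ (K - n) - 1) : ℕ)) : ℝ) + 7 * (F.L : ℝ) ^ (K - n))) ≤ 20 * ε₀ := by
    calc (F.L : ℝ) ^ (K - n) * (2 * regThreshold F n K ε₀ * (((((F.P K).d * ((F.P K).L ^ (K - n) - 1) : ℕ)) : ℝ) + 7 * (F.L : ℝ) ^ (K - n)))
        ≤ (F.L : ℝ) ^ (K - n) * (2 * regThreshold F n K ε₀ * (3 * (F.L : ℝ) ^ (K - n) + 7 * (F.L : ℝ) ^ (K - n))) := by gcongr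
      _ = 20 * (regThreshold F n K ε₀ * ((F.L : ℝ) ^ (K - n)) ^ 2) := by ring
      _ = 20 * ε₀ := by rw [regThreshold_mul_sq]
  have h2nn : 0 ≤ (F.L : ℝ) ^ (K - n) * (2 * regThreshold F n K ε₀ * (((((F.P K).d * ((F.P K).L ^ (K - n) - 1) : ℕ)) : ℝ) + 7 * (F.L : ℝ) ^ (K - n))) := by positivity
  have h2sq : ((F.L : ℝ) ^ (K - n) * (2 * regThreshold F n K ε₀ * (((((F.P K).d * ((F.P K).L ^ (K - n) - 1) : ℕ)) : ℝ) + 7 * (F.L : ℝ) ^ (K - n)))) ^ 2 ≤ (20 * ε₀) ^ 2 :=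
    pow_le_pow_left₀ h2nn h2 2
  -- `ε₀ ≤ 10⁻¹⁰`, `10¹⁰L¹⁰ε₀² ≤ 10⁻¹⁰`
  have hL6 : (1 : ℝ) ≤ (F.L : ℝ) ^ 6 := one_le_pow₀ hL1
  have hε1 : ε₀ ≤ (10 : ℝ)⁻¹ ^ 10 := by
    have h1 : 10 ^ 10 * ε₀ ≤ 1 := by nlinarith
    calc ε₀ = (10 ^ 10 * ε₀) * (10 ^ 10 : ℝ)⁻¹ := by ring
      _ ≤ 1 * (10 ^ 10 : ℝ)⁻¹ := mul_le_mul_of_nonneg_right h1 (by positivity)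
      _ = (10 : ℝ)⁻¹ ^ 10 := by rw [one_mul, inv_pow]
  have ht1 : 3 * 10 ^ 10 * (F.L : ℝ) ^ 10 * ε₀ ^ 2 ≤ 3 * (10 : ℝ)⁻¹ ^ 10 := by
    -- `10¹⁰L¹⁰ε₀² = (10¹⁰L⁶ε₀)·(L⁴ε₀) ≤ L⁴ε₀ ≤ L⁴·10⁻¹⁰L⁻⁶ ≤ 10⁻¹⁰`
    have hA : 10 ^ 10 * (F.L : ℝ) ^ 10 * ε₀ ^ 2 = (10 ^ 10 * (F.L : ℝ) ^ 6 * ε₀) * ((F.L : ℝ) ^ 4 * ε₀) := by ring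
    have hB : (F.L : ℝ) ^ 4 * ε₀ ≤ (10 : ℝ)⁻¹ ^ 10 := by
      -- from `10¹⁰L⁶ε₀ ≤ 1`: `L⁴ε₀ ≤ L⁶ε₀ ≤ 10⁻¹⁰`
      have hL4 : (F.L : ℝ) ^ 4 * ε₀ ≤ (F.L : ℝ) ^ 6 * ε₀ := mul_le_mul_of_nonneg_right (pow_le_pow_right₀ hL1 (by norm_num)) hε₀.le
      have hL6' : (F.L : ℝ) ^ 6 * ε₀ ≤ (10 : ℝ)⁻¹ ^ 10 := by
        calc (F.L : ℝ) ^ 6 * ε₀ = (10 ^ 10 * (F.L : ℝ) ^ 6 * ε₀) * (10 ^ 10 : ℝ)⁻¹ := by ring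
          _ ≤ 1 * (10 ^ 10 : ℝ)⁻¹ := mul_le_mul_of_nonneg_right hε (by positivity)
          _ = (10 : ℝ)⁻¹ ^ 10 := by rw [one_mul, inv_pow]
      exact hL4.trans hL6'
    rw [mul_assoc 3, mul_assoc 3, hA]
    refine mul_le_mul_of_nonneg_left ?_ (by norm_num)
    calc (10 ^ 10 * (F.L : ℝ) ^ 6 * ε₀) * ((F.L : ℝ) ^ 4 * ε₀) ≤ 1 * ((F.L : ℝ) ^ 4 * ε₀) := mul_le_mul_of_nonneg_right hε (by positivity)
      _ ≤ (10 : ℝ)⁻¹ ^ 10 := by rw [one_mul]; exact hB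
  have ht2 : 192 * ((F.L : ℝ) ^ (K - n) * (2 * regThreshold F n K ε₀ * (((((F.P K).d * ((F.P K).L ^ (K - n) - 1) : ℕ)) : ℝ) + 7 * (F.L : ℝ) ^ (K - n)))) ^ 2
      ≤ 192 * (400 * ((10 : ℝ)⁻¹ ^ 10) ^ 2) := by
    refine mul_le_mul_of_nonneg_left (h2sq.trans ?_) (by norm_num)
    have : (20 * ε₀) ^ 2 = 400 * ε₀ ^ 2 := by ring
    rw [this]
    exact mul_le_mul_of_nonneg_left (pow_le_pow_left₀ hε₀.le hε1 2) (by norm_num)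
  calc 4 * (3 * 10 ^ 10 * (F.L : ℝ) ^ 10 * ε₀ ^ 2
          + 192 * ((F.L : ℝ) ^ (K - n) * (2 * regThreshold F n K ε₀ * (((((F.P K).d * ((F.P K).L ^ (K - n) - 1) : ℕ)) : ℝ) + 7 * (F.L : ℝ) ^ (K - n)))) ^ 2)
      ≤ 4 * (3 * (10 : ℝ)⁻¹ ^ 10 + 192 * (400 * ((10 : ℝ)⁻¹ ^ 10) ^ 2)) := by linarith
    _ ≤ (10 : ℝ)⁻¹ ^ 8 := by norm_num

end Window

/-! ## §4 ★★★ The transported interpolant at the skew ⊗ parabola² profile -/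

section Member

variable (F : T3Family) (n K : ℕ) (h : n ≤ K) (c₀ cB : ℝ) [Fact (0 < c₀)] [Fact (0 < cB)]

/-- ★★★ **(K1b-a) — THE TRANSPORTED APPROXIMATE RIGHT INVERSE OF `Q_k(U₀)` ON `RegPr`, K-FREE**: `RegPr F n K ε₀ U₀`, `10¹⁰L⁶ε₀ ≤ 1`, `10¹²L³ε₀ ≤ 1`, `n < K`,
no-wrap `2(3(ℓ−1) + 8ℓ + 1) ≤ (F.P K).sitesPerDir 0` ⟹ `∃ E : WL2 →ₗ[ℂ] BondL2K` with (formula) `toL2⁻¹(E c)(b) = ψ(b) • Ad_{(σ_{ŷ_b}(b₋)♭)⁻¹}(m̂⁻¹ • Ad_{Φ(B^k b₋)}(toL2B⁻¹c)(e⁻¹ŷ_b))` for the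
skew ⊗ parabola² profile `ψ`, (a) `‖Q_k(U₀)(E c) − c‖ ≤ ½‖c‖`, (s1) `‖E c‖ ≤ 45·√(c₀·ℓ³∕cB)·‖c‖` (`= 45` at the pin `cB = c₀ℓ³`) — ✓`exists_transportedInterpolant` with §1–§3:
`SPILL∕OWN ≤ ⅓`, `6ρ·m̂⁻²Ψ₂∕ℓ³ ≤ 11757·ρ ≤ 11757·10⁻⁸ ≤ 1∕36`, `m̂⁻²Ψ₂ ≤ 1960·ℓ³`.  The letters `E`, `hQE` (`θ = ½`), `hE₁` of px12 ✓`Prop7KinvBoundOfInterpolant.norm_KinvT_le_of_interpolant_rows`;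
`hED` ((s2)) is the next file. [cite: Balaban1985BackgroundPropagators, (3.13)–(3.16) p.393, (3.126)–(3.132) pp.420–422; Balaban1984PropagatorsI, (1.18) p.20, (1.47)–(1.50) p.26] -/
theorem exists_transportedInterpolant_of_regPr {ε₀ : ℝ} (hε₀ : 0 < ε₀) (hε : 10 ^ 10 * (F.L : ℝ) ^ 6 * ε₀ ≤ 1) (hε12 : 10 ^ 12 * (F.L : ℝ) ^ 3 * ε₀ ≤ 1)
    (U₀ : GaugeField (F.P K) 0 (Matrix.specialUnitaryGroup (Fin 2) ℂ)) (hreg : RegPr F n K ε₀ U₀) (hnK : n < K)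
    (hwrap : 2 * ((F.P K).d * ((F.P K).L ^ (K - n) - 1) + 8 * (F.P K).L ^ (K - n) + 1) ≤ (F.P K).sitesPerDir 0) :
    ∃ E : WL2 ℂ (fun _ : PBond (F.P n) 0 => cB) W₂ →ₗ[ℂ] BondL2K ℂ 3 (periodsT3 F K) c₀ W₂,
      (∀ (c : WL2 ℂ (fun _ : PBond (F.P n) 0 => cB) W₂) (b : PBond (F.P K) 0), (toL2 F K c₀).symm (E c) b
          = (((((b.src b.dir).val % (F.P K).L ^ (K - n) + 1 - ((F.P K).L ^ (K - n) - ((F.P K).L ^ (K - n) / 4 + 1)) : ℕ) : ℝ) * ((((F.P K).L ^ (K - n) : ℕ) : ℝ) - (((b.src b.dir).val % (F.P K).L ^ (K - n) : ℕ) : ℝ))) * ∏ ν ∈ univ.erase b.dir, ((((b.src ν).val % (F.P K).L ^ (K - n) : ℕ) : ℝ) * ((((F.P K).L ^ (K - n) : ℕ) : ℝ) - 1 - (((b.src ν).val % (F.P K).L ^ (K - n) : ℕ) : ℝ))))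
            • conjR (Unitary.toUnits (suIncl ((axialT U₀ (Site.fibreSite 0 (K - n) (iterBlockOf (K - n) b.src) fun _ => (⟨0, pow_pos (F.P K).L_pos (K - n)⟩ : Fin ((F.P K).L ^ (K - n))))) b.src)))⁻¹
              (((∑ s ∈ range ((F.P K).L ^ (K - n)), ((s : ℝ) + 1) * (((s + 1 - ((F.P K).L ^ (K - n) - ((F.P K).L ^ (K - n) / 4 + 1)) : ℕ) : ℝ) * ((((F.P K).L ^ (K - n) : ℕ) : ℝ) - ((s : ℕ) : ℝ)))) * (∑ a ∈ range ((F.P K).L ^ (K - n)), (((a : ℕ) : ℝ) * ((((F.P K).L ^ (K - n) : ℕ) : ℝ) - 1 - ((a : ℕ) : ℝ)))) ^ ((F.P K).d - 1) * ((((F.P K).L : ℝ) ^ ((F.P K).d + 1)) ^ (K - n))⁻¹)⁻¹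
                • conjR (axialT (unitsField (toUField U₀)) (Site.fibreSite 0 (K - n) (iterBlockOf (K - n) b.src) fun _ => (⟨0, pow_pos (F.P K).L_pos (K - n)⟩ : Fin ((F.P K).L ^ (K - n)))) (embIter (K - n) (iterBlockOf (K - n) b.src)))
                  ((toL2B F n cB).symm c ((bondShift (sites_eq F n K h)).symm ⟨iterBlockOf (K - n) b.src, b.dir⟩))))
      ∧ (∀ c : WL2 ℂ (fun _ : PBond (F.P n) 0 => cB) W₂, ‖Qk F n K h c₀ cB U₀ (E c) - c‖ ≤ (1 / 2) * ‖c‖)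
      ∧ (∀ c : WL2 ℂ (fun _ : PBond (F.P n) 0 => cB) W₂, ‖E c‖ ≤ 45 * Real.sqrt (c₀ * ((F.L : ℝ) ^ (K - n)) ^ 3 / cB) * ‖c‖) := by
  classical
  have hcB : (0 : ℝ) < cB := Fact.out
  have hc₀ : (0 : ℝ) < c₀ := Fact.out
  have hd : (F.P K).d = 3 := T3Family.P_d F K
  have hL3 : 3 ≤ F.L := by obtain ⟨a, ha⟩ := F.hL.1; have := F.hL.2; omega
  have hk1 : 1 ≤ K - n := by omega
  have hℓ3 : 3 ≤ (F.P K).L ^ (K - n) :=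
    le_trans (by simpa using hL3) (Nat.pow_le_pow_right (F.P K).L_pos hk1)
  have hℓ1 : 1 ≤ (F.P K).L ^ (K - n) := le_trans (by norm_num) hℓ3
  have hℓcast : ((((F.P K).L ^ (K - n) : ℕ)) : ℝ) = (F.L : ℝ) ^ (K - n) := by push_cast; rfl
  have hℓpos : (0 : ℝ) < (F.L : ℝ) ^ (K - n) := by rw [← hℓcast]; exact_mod_cast (lt_of_lt_of_le (by norm_num) hℓ1)
  -- the one-dimensional sums of the two profiles
  have hOWN : 0 < ∑ s ∈ range ((F.P K).L ^ (K - n)), ((s : ℝ) + 1) * (fun s : ℕ => (((s + 1 - ((F.P K).L ^ (K - n) - ((F.P K).L ^ (K - n) / 4 + 1)) : ℕ) : ℝ) * ((((F.P K).L ^ (K - n) : ℕ) : ℝ) - ((s : ℕ) : ℝ)))) s := by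
    simp only []
    exact sum_own_skew_pos hℓ1
  have hT : (∑ a ∈ range ((F.P K).L ^ (K - n)), (fun m : ℕ => (((m : ℕ) : ℝ) * ((((F.P K).L ^ (K - n) : ℕ) : ℝ) - 1 - ((m : ℕ) : ℝ)))) a) ≠ 0 := by
    simp only []
    exact (sum_tau_pos hℓ3).ne'
  obtain ⟨E, hf, hQE, hE1⟩ := exists_transportedInterpolant F n K h c₀ cB hε₀ hε hε12 U₀ hreg (fun s : ℕ => (((s + 1 - ((F.P K).L ^ (K - n) - ((F.P K).L ^ (K - n) / 4 + 1)) : ℕ) : ℝ) * ((((F.P K).L ^ (K - n) : ℕ) : ℝ) - ((s : ℕ) : ℝ)))) (fun m : ℕ => (((m : ℕ) : ℝ) * ((((F.P K).L ^ (K - n) : ℕ) : ℝ) - 1 - ((m : ℕ) : ℝ)))) hOWN hT hwrap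
  -- THE NUMBERS: sums as atoms, `d = 3`, `ℓ = L^k`
  have hS := cube_mul_sum_skew_sq_le hℓ1
  have hU := sq_mul_sum_tau_sq_sq_le hℓ3
  have hsp3 := three_mul_sum_spill_le_sum_own ((F.P K).L ^ (K - n))
  have hSPnn := sum_spill_skew_nonneg ((F.P K).L ^ (K - n))
  have hTpos := sum_tau_pos hℓ3
  have hρ := rho_le F n K hε₀ hε
  rw [← Fin.sum_univ_eq_sum_range (fun s => (((s + 1 - ((F.P K).L ^ (K - n) - ((F.P K).L ^ (K - n) / 4 + 1)) : ℕ) : ℝ) * ((((F.P K).L ^ (K - n) : ℕ) : ℝ) - ((s : ℕ) : ℝ))) ^ 2) ((F.P K).L ^ (K - n))] at hS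
  rw [← Fin.sum_univ_eq_sum_range (fun a => (((a : ℕ) : ℝ) * ((((F.P K).L ^ (K - n) : ℕ) : ℝ) - 1 - ((a : ℕ) : ℝ))) ^ 2) ((F.P K).L ^ (K - n))] at hU
  simp only [] at hOWN hT hQE hE1 hS hU
  set OWN : ℝ := ∑ s ∈ range ((F.P K).L ^ (K - n)), ((s : ℝ) + 1) * (((s + 1 - ((F.P K).L ^ (K - n) - ((F.P K).L ^ (K - n) / 4 + 1)) : ℕ) : ℝ) * ((((F.P K).L ^ (K - n) : ℕ) : ℝ) - ((s : ℕ) : ℝ))) with hOWNd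
  set SPILL : ℝ := ∑ s ∈ range ((F.P K).L ^ (K - n)), (((((F.P K).L ^ (K - n) : ℕ) : ℝ)) - 1 - (s : ℝ)) * (((s + 1 - ((F.P K).L ^ (K - n) - ((F.P K).L ^ (K - n) / 4 + 1)) : ℕ) : ℝ) * ((((F.P K).L ^ (K - n) : ℕ) : ℝ) - ((s : ℕ) : ℝ))) with hSPILLd
  set T : ℝ := ∑ a ∈ range ((F.P K).L ^ (K - n)), (((a : ℕ) : ℝ) * ((((F.P K).L ^ (K - n) : ℕ) : ℝ) - 1 - ((a : ℕ) : ℝ))) with hTd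
  set S2 : ℝ := ∑ a : Fin ((F.P K).L ^ (K - n)), ((((a : ℕ) + 1 - ((F.P K).L ^ (K - n) - ((F.P K).L ^ (K - n) / 4 + 1)) : ℕ) : ℝ) * ((((F.P K).L ^ (K - n) : ℕ) : ℝ) - (((a : ℕ) : ℕ) : ℝ))) ^ 2 with hS2d
  set U2 : ℝ := ∑ a : Fin ((F.P K).L ^ (K - n)), ((((a : ℕ) : ℕ) : ℝ) * ((((F.P K).L ^ (K - n) : ℕ) : ℝ) - 1 - (((a : ℕ) : ℕ) : ℝ))) ^ 2 with hU2d
  set ρ : ℝ := 4 * (3 * 10 ^ 10 * (F.L : ℝ) ^ 10 * ε₀ ^ 2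
      + 192 * ((F.L : ℝ) ^ (K - n) * (2 * regThreshold F n K ε₀ * (((((F.P K).d * ((F.P K).L ^ (K - n) - 1) : ℕ)) : ℝ) + 7 * (F.L : ℝ) ^ (K - n)))) ^ 2) with hρd
  have hρ0 : 0 ≤ ρ := by
    rw [hρd]; have := regThreshold_pos F (n := n) (K := K) hε₀; positivity
  have hPL : (((F.P K).L : ℕ) : ℝ) = (F.L : ℝ) := rfl
  rw [hℓcast] at hS hU
  set ℓF : ℝ := (F.L : ℝ) ^ (K - n) with hℓFd
  have h4 : (((F.P K).L : ℝ) ^ ((F.P K).d + 1)) ^ (K - n) = ℓF ^ 4 := by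
    rw [hd, hPL, ← pow_mul, mul_comm, pow_mul]
  have hd1 : (F.P K).d - 1 = 2 := by rw [hd]
  have hd3 : ((F.P K).d : ℝ) = 3 := by rw [hd]; norm_num
  rw [h4, hd1] at hE1
  rw [h4, hd1, hd3, hd] at hQE
  have hS2nn : 0 ≤ S2 := by rw [hS2d]; exact Finset.sum_nonneg fun _ _ => sq_nonneg _
  have hU2nn : 0 ≤ U2 := by rw [hU2d]; exact Finset.sum_nonneg fun _ _ => sq_nonneg _
  have hc₀' : c₀ ≠ 0 := hc₀.ne'
  have hcB' : cB ≠ 0 := hcB.ne'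
  have hℓF' : ℓF ≠ 0 := hℓpos.ne'
  have hOWN' : OWN ≠ 0 := hOWN.ne'
  have hT' : T ≠ 0 := hTpos.ne'
  -- forget the definitions of the atoms (keeps `field_simp`∕`ring` small)
  clear_value OWN SPILL T S2 U2 ρ ℓF
  -- `(ℓ³Σp²)(ℓ²(Στ²)²) ≤ 43·OWN² · (729/16)·T⁴`
  have hP : (ℓF ^ 3 * S2) * (ℓF ^ 2 * U2 ^ 2) ≤ (43 * OWN ^ 2) * (729 / 16 * T ^ 4) := by
    have hU' : ℓF ^ 2 * U2 ^ 2 ≤ 729 / 16 * T ^ 4 := by nlinarith [hU]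
    exact mul_le_mul hS hU' (by positivity) (by positivity)
  refine ⟨E, fun c b => hf c b, fun c => (hQE c).trans (mul_le_mul_of_nonneg_right ?_ (norm_nonneg c)), fun c => ?_⟩
  · -- θ ≤ ½
    have hA : |SPILL| / OWN ≤ 1 / 3 := by
      rw [abs_of_nonneg hSPnn, div_le_iff₀ hOWN]; linarith
    have hrad : 2 * 3 * ρ * (cB / (c₀ * ℓF ^ 3)) * (c₀ * ((OWN * T ^ 2 * (ℓF ^ 4)⁻¹)⁻¹ ^ 2 * (S2 * U2 ^ 2)) * cB⁻¹) ≤ 1 / 36 := by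
      have heq : 2 * 3 * ρ * (cB / (c₀ * ℓF ^ 3)) * (c₀ * ((OWN * T ^ 2 * (ℓF ^ 4)⁻¹)⁻¹ ^ 2 * (S2 * U2 ^ 2)) * cB⁻¹)
          = 6 * ρ * ((ℓF ^ 3 * S2) * (ℓF ^ 2 * U2 ^ 2)) / (OWN ^ 2 * T ^ 4) := by
        field_simp
        ring
      rw [heq, div_le_iff₀ (by positivity)]
      calc 6 * ρ * ((ℓF ^ 3 * S2) * (ℓF ^ 2 * U2 ^ 2)) ≤ 6 * ((10 : ℝ)⁻¹ ^ 8) * ((43 * OWN ^ 2) * (729 / 16 * T ^ 4)) := by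
            gcongr
        _ = (6 * (10 : ℝ)⁻¹ ^ 8 * 43 * (729 / 16)) * (OWN ^ 2 * T ^ 4) := by ring
        _ ≤ 1 / 36 * (OWN ^ 2 * T ^ 4) := mul_le_mul_of_nonneg_right (by norm_num) (by positivity)
    calc |SPILL| / OWN + Real.sqrt (2 * 3 * ρ * (cB / (c₀ * ℓF ^ 3)) * (c₀ * ((OWN * T ^ 2 * (ℓF ^ 4)⁻¹)⁻¹ ^ 2 * (S2 * U2 ^ 2)) * cB⁻¹))
        ≤ 1 / 3 + Real.sqrt (1 / 36) := add_le_add hA (Real.sqrt_le_sqrt hrad)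
      _ = 1 / 2 := by
          rw [show (1 / 36 : ℝ) = (1 / 6) ^ 2 by norm_num, Real.sqrt_sq (by norm_num)]
          norm_num
  · -- C₁ ≤ 45 √(c₀ℓ³/cB)
    have hE := hE1 c
    have hM : c₀ * ((OWN * T ^ 2 * (ℓF ^ 4)⁻¹)⁻¹ ^ 2 * (S2 * U2 ^ 2)) * (cB⁻¹ * ‖c‖ ^ 2) ≤ (45 * Real.sqrt (c₀ * ℓF ^ 3 / cB) * ‖c‖) ^ 2 := by
      rw [mul_pow, mul_pow, Real.sq_sqrt (by positivity)]
      have hkey : (OWN * T ^ 2 * (ℓF ^ 4)⁻¹)⁻¹ ^ 2 * (S2 * U2 ^ 2) ≤ 1960 * ℓF ^ 3 := by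
        have heq : (OWN * T ^ 2 * (ℓF ^ 4)⁻¹)⁻¹ ^ 2 * (S2 * U2 ^ 2) = ℓF ^ 3 * ((ℓF ^ 3 * S2) * (ℓF ^ 2 * U2 ^ 2)) / (OWN ^ 2 * T ^ 4) := by
          field_simp
        rw [heq, div_le_iff₀ (by positivity)]
        calc ℓF ^ 3 * ((ℓF ^ 3 * S2) * (ℓF ^ 2 * U2 ^ 2)) ≤ ℓF ^ 3 * ((43 * OWN ^ 2) * (729 / 16 * T ^ 4)) :=
              mul_le_mul_of_nonneg_left hP (by positivity)
          _ = (43 * 729 / 16) * (ℓF ^ 3 * (OWN ^ 2 * T ^ 4)) := by ring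
          _ ≤ 1960 * (ℓF ^ 3 * (OWN ^ 2 * T ^ 4)) := mul_le_mul_of_nonneg_right (by norm_num) (by positivity)
          _ = 1960 * ℓF ^ 3 * (OWN ^ 2 * T ^ 4) := by ring
      calc c₀ * ((OWN * T ^ 2 * (ℓF ^ 4)⁻¹)⁻¹ ^ 2 * (S2 * U2 ^ 2)) * (cB⁻¹ * ‖c‖ ^ 2)
          ≤ c₀ * (1960 * ℓF ^ 3) * (cB⁻¹ * ‖c‖ ^ 2) := by gcongr
        _ = 1960 * ((c₀ * ℓF ^ 3 / cB) * ‖c‖ ^ 2) := by ring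
        _ ≤ 45 ^ 2 * (c₀ * ℓF ^ 3 / cB) * ‖c‖ ^ 2 := by
            have hx : 0 ≤ (c₀ * ℓF ^ 3 / cB) * ‖c‖ ^ 2 := by positivity
            linarith
    calc ‖E c‖ = Real.sqrt (‖E c‖ ^ 2) := (Real.sqrt_sq (norm_nonneg _)).symm
      _ ≤ Real.sqrt ((45 * Real.sqrt (c₀ * ℓF ^ 3 / cB) * ‖c‖) ^ 2) := Real.sqrt_le_sqrt (by rw [hE]; exact hM)
      _ = 45 * Real.sqrt (c₀ * ℓF ^ 3 / cB) * ‖c‖ := Real.sqrt_sq (by positivity)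

end Member

end Summit.QuantumFields.YangMills.Theorems.Prop7TransportedInterpolantOfRegPr

end
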